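import Mathlib
import Literature.Analysis.FluidPDE.VectorCalculus
import Literature.Analysis.FluidPDE.CKNInterpolationEstimate
import Literature.Analysis.FluidPDE.TaoEnstrophyLocalisationProofs
import HarnessLib.Audit
import HarnessLib

/-!
# Ball growth of `|f| dx` from a Morrey bound plus energy, and `‖∇|f|²‖₁ ≤ 2‖f‖₂‖∇f‖₂`
# (route `L3TimeExponentPincer`, item `stmt-NavierStokesRegularity-19499`, support file 2/4 of THEOREM J′)

Support file (cell ns-regularity-ideate, seat p2, ROUND-9).  Pure real analysis on `ℝ³`, 0 `sorry`:

* `ballGrowth_of_morrey` : if `∫|f|² ≤ e₀` and `∫_{B(x₀,r)}|f|² ≤ M r` for all `x₀` and all `r < r₁`, then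
  `∫_{B(x,r)}|f| ≤ K r²` for ALL balls, `K = growthConst M e₀ r₁ = |B₁|^{1/2}(M^{1/2} + (e₀/r₁)^{1/2})`
  (Cauchy–Schwarz on the ball; Morrey regime `r < r₁`, energy regime `r ≥ r₁`);
* `norm_fderiv_norm_sq_le`, `lintegral_enorm_fderiv_norm_sq_le` : `‖∇|f|²‖ ≤ 2|f|‖∇f‖_F` pointwise and
  `‖∇|f|²‖₁ ≤ 2‖f‖₂‖∇f‖₂`, with the Frobenius norm `Literature.Analysis.FluidPDE.frobeniusNormSq` of the tree.
-/

noncomputable section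

namespace Summit.NavierStokesRegularity.NavierStokesRegularity.Theorems.L3TimeExponentPincerMorreyGrowth

open MeasureTheory Set Function Filter Metric Topology
open scoped ENNReal NNReal
open Literature.Analysis.FluidPDE

/-! ### Ball growth of `μ = |f| dx` from the Morrey bound and the energy (Cauchy–Schwarz) -/

/-- `|B(0,1)|` as a real number. -/
def V₁ : ℝ := (volume (ball (0 : (EuclideanSpace ℝ (Fin 3))) 1)).toReal

/-- `|B(x,r)| = V₁ r³` in `ℝ³`. -/
theorem volume_ball_eq (x : (EuclideanSpace ℝ (Fin 3))) {r : ℝ} (hr : 0 < r) :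
    volume (ball x r) = ENNReal.ofReal (r ^ 3 * V₁) := by
  rw [Measure.addHaar_ball_of_pos volume x hr, finrank_euclideanSpace_fin, V₁,
    ENNReal.ofReal_mul (by positivity), ENNReal.ofReal_toReal measure_ball_lt_top.ne]

/-- `0 ≤ V₁`. -/
theorem V₁_nonneg : 0 ≤ V₁ := ENNReal.toReal_nonneg

/-- Cauchy–Schwarz on a ball: `∫_B |f| ≤ (∫_B |f|²)^{1/2} |B|^{1/2}`. -/
theorem setLIntegral_enorm_le_sqrt {f : (EuclideanSpace ℝ (Fin 3)) → (EuclideanSpace ℝ (Fin 3))} (hf : Measurable f) (x : (EuclideanSpace ℝ (Fin 3))) {r : ℝ} (hr : 0 < r) :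
    ∫⁻ y in ball x r, ‖f y‖ₑ ≤
      (∫⁻ y in ball x r, ‖f y‖ₑ ^ 2) ^ (1 / 2 : ℝ) * ENNReal.ofReal (Real.sqrt (r ^ 3 * V₁)) := by
  have h := ENNReal.lintegral_mul_le_Lp_mul_Lq (volume.restrict (ball x r))
    Real.HolderConjugate.two_two hf.enorm.aemeasurable (g := fun _ => (1 : ℝ≥0∞)) aemeasurable_const
  simp only [Pi.mul_apply, mul_one, ENNReal.one_rpow, lintegral_const, Measure.restrict_apply,
    MeasurableSet.univ, univ_inter, one_mul] at h
  refine h.trans (le_of_eq ?_)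
  congr 1
  · congr 1
    refine lintegral_congr fun y => ?_
    rw [ENNReal.rpow_two]
  · rw [volume_ball_eq x hr, ENNReal.ofReal_rpow_of_nonneg (mul_nonneg (by positivity) V₁_nonneg)
      (by norm_num), Real.sqrt_eq_rpow]

/-- the growth constant `K(M, e₀, r₁) = √V₁ (√M + √(e₀/r₁))`. -/
def growthConst (M e₀ r₁ : ℝ) : ℝ≥0 := (Real.sqrt V₁ * (Real.sqrt M + Real.sqrt (e₀ / r₁))).toNNReal

/-- The growth constant as an extended real. -/
theorem coe_growthConst (M e₀ r₁ : ℝ) :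
    ((growthConst M e₀ r₁ : ℝ≥0) : ℝ≥0∞) =
      ENNReal.ofReal (Real.sqrt V₁ * (Real.sqrt M + Real.sqrt (e₀ / r₁))) := rfl

/-- **Ball growth.** Morrey `∫_{B_r}|f|² ≤ M r` (`r < r₁`) and energy `∫|f|² ≤ e₀` give
`∫_{B(x,r)} |f| ≤ K r²` for ALL `r > 0`. -/
theorem ballGrowth_of_morrey {f : (EuclideanSpace ℝ (Fin 3)) → (EuclideanSpace ℝ (Fin 3))} (hf : Measurable f) {M e₀ r₁ : ℝ} (hM : 0 < M)
    (he₀ : 0 ≤ e₀) (hr₁ : 0 < r₁) (hE : ∫⁻ y, ‖f y‖ₑ ^ 2 ≤ ENNReal.ofReal e₀)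
    (hMor : ∀ x₀ : (EuclideanSpace ℝ (Fin 3)), ∀ r : ℝ, 0 < r → r < r₁ → ∫⁻ y in ball x₀ r, ‖f y‖ₑ ^ 2 ≤ ENNReal.ofReal (M * r)) :
    ∀ (x : (EuclideanSpace ℝ (Fin 3))) (r : ℝ), 0 < r →
      ∫⁻ y in ball x r, ‖f y‖ₑ ≤ (growthConst M e₀ r₁ : ℝ≥0∞) * ENNReal.ofReal (r ^ 2) := by
  intro x r hr
  rw [coe_growthConst, ← ENNReal.ofReal_mul (by positivity)]
  refine (setLIntegral_enorm_le_sqrt hf x hr).trans ?_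
  have hV := V₁_nonneg
  by_cases hrr : r < r₁
  · -- Morrey regime
    have h1 : (∫⁻ y in ball x r, ‖f y‖ₑ ^ 2) ^ (1 / 2 : ℝ) ≤ ENNReal.ofReal (Real.sqrt (M * r)) := by
      calc (∫⁻ y in ball x r, ‖f y‖ₑ ^ 2) ^ (1 / 2 : ℝ) ≤ (ENNReal.ofReal (M * r)) ^ (1 / 2 : ℝ) :=
            ENNReal.rpow_le_rpow (hMor x r hr hrr) (by norm_num)
        _ = ENNReal.ofReal (Real.sqrt (M * r)) := by
            rw [ENNReal.ofReal_rpow_of_nonneg (by positivity) (by norm_num), Real.sqrt_eq_rpow]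
    calc (∫⁻ y in ball x r, ‖f y‖ₑ ^ 2) ^ (1 / 2 : ℝ) * ENNReal.ofReal (Real.sqrt (r ^ 3 * V₁))
        ≤ ENNReal.ofReal (Real.sqrt (M * r)) * ENNReal.ofReal (Real.sqrt (r ^ 3 * V₁)) := by
          gcongr
      _ = ENNReal.ofReal (Real.sqrt V₁ * Real.sqrt M * r ^ 2) := by
          rw [← ENNReal.ofReal_mul (Real.sqrt_nonneg _)]
          congr 1
          rw [Real.sqrt_mul hM.le, Real.sqrt_mul (by positivity),
            show r ^ 3 = r ^ 2 * r by ring, Real.sqrt_mul (by positivity), Real.sqrt_sq hr.le]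
          have : Real.sqrt r * Real.sqrt r = r := Real.mul_self_sqrt hr.le
          calc Real.sqrt M * Real.sqrt r * (r * Real.sqrt r * Real.sqrt V₁)
              = Real.sqrt M * Real.sqrt V₁ * r * (Real.sqrt r * Real.sqrt r) := by ring
            _ = Real.sqrt V₁ * Real.sqrt M * r ^ 2 := by rw [this]; ring
      _ ≤ ENNReal.ofReal (Real.sqrt V₁ * (Real.sqrt M + Real.sqrt (e₀ / r₁)) * r ^ 2) := by
          apply ENNReal.ofReal_le_ofReal
          have : 0 ≤ Real.sqrt V₁ * Real.sqrt (e₀ / r₁) * r ^ 2 := by positivity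
          nlinarith
  · -- energy regime `r ≥ r₁`
    have hrr' : r₁ ≤ r := le_of_not_gt hrr
    have h1 : (∫⁻ y in ball x r, ‖f y‖ₑ ^ 2) ^ (1 / 2 : ℝ) ≤ ENNReal.ofReal (Real.sqrt e₀) := by
      calc (∫⁻ y in ball x r, ‖f y‖ₑ ^ 2) ^ (1 / 2 : ℝ) ≤ (ENNReal.ofReal e₀) ^ (1 / 2 : ℝ) :=
            ENNReal.rpow_le_rpow ((setLIntegral_le_lintegral _ _).trans hE) (by norm_num)
        _ = ENNReal.ofReal (Real.sqrt e₀) := by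
            rw [ENNReal.ofReal_rpow_of_nonneg he₀ (by norm_num), Real.sqrt_eq_rpow]
    have hsq : Real.sqrt r₁ ≤ Real.sqrt r := Real.sqrt_le_sqrt hrr'
    have hr₁s : 0 < Real.sqrt r₁ := Real.sqrt_pos.2 hr₁
    calc (∫⁻ y in ball x r, ‖f y‖ₑ ^ 2) ^ (1 / 2 : ℝ) * ENNReal.ofReal (Real.sqrt (r ^ 3 * V₁))
        ≤ ENNReal.ofReal (Real.sqrt e₀) * ENNReal.ofReal (Real.sqrt (r ^ 3 * V₁)) := by gcongr
      _ = ENNReal.ofReal (Real.sqrt V₁ * Real.sqrt e₀ * (r * Real.sqrt r)) := by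
          rw [← ENNReal.ofReal_mul (Real.sqrt_nonneg _)]
          congr 1
          rw [Real.sqrt_mul (by positivity), show r ^ 3 = r ^ 2 * r by ring,
            Real.sqrt_mul (by positivity), Real.sqrt_sq hr.le]
          ring
      _ ≤ ENNReal.ofReal (Real.sqrt V₁ * (Real.sqrt M + Real.sqrt (e₀ / r₁)) * r ^ 2) := by
          apply ENNReal.ofReal_le_ofReal
          -- `√e₀ · r√r ≤ √(e₀/r₁) r²` since `√r₁ ≤ √r`
          have h2 : Real.sqrt e₀ * (r * Real.sqrt r) ≤ Real.sqrt (e₀ / r₁) * r ^ 2 := by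
            rw [Real.sqrt_div' e₀ hr₁.le]  -- hmm
            rw [div_mul_eq_mul_div, le_div_iff₀ hr₁s]
            calc Real.sqrt e₀ * (r * Real.sqrt r) * Real.sqrt r₁
                ≤ Real.sqrt e₀ * (r * Real.sqrt r) * Real.sqrt r := by gcongr
              _ = Real.sqrt e₀ * r ^ 2 := by
                  rw [show Real.sqrt e₀ * (r * Real.sqrt r) * Real.sqrt r =
                    Real.sqrt e₀ * r * (Real.sqrt r * Real.sqrt r) by ring, Real.mul_self_sqrt hr.le]
                  ring
          have h3 : 0 ≤ Real.sqrt V₁ * Real.sqrt M * r ^ 2 := by positivity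
          calc Real.sqrt V₁ * Real.sqrt e₀ * (r * Real.sqrt r)
              = Real.sqrt V₁ * (Real.sqrt e₀ * (r * Real.sqrt r)) := by ring
            _ ≤ Real.sqrt V₁ * (Real.sqrt (e₀ / r₁) * r ^ 2) := by gcongr
            _ ≤ Real.sqrt V₁ * (Real.sqrt M + Real.sqrt (e₀ / r₁)) * r ^ 2 := by nlinarith

/-! ### `‖∇|f|²‖₁ ≤ 2 ‖f‖₂ ‖∇f‖₂` -/

/-- Pointwise `‖∇|f|²‖ ≤ 2 |f| ‖∇f‖_F`. -/
theorem norm_fderiv_norm_sq_le {f : (EuclideanSpace ℝ (Fin 3)) → (EuclideanSpace ℝ (Fin 3))} (hf : ContDiff ℝ 1 f) (x : (EuclideanSpace ℝ (Fin 3))) :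
    ‖fderiv ℝ (fun y => ‖f y‖ ^ 2) x‖ ≤ 2 * ‖f x‖ * Real.sqrt (frobeniusNormSq (fderiv ℝ f x)) := by
  have hd : HasFDerivAt f (fderiv ℝ f x) x := (hf.differentiable one_ne_zero).differentiableAt.hasFDerivAt
  rw [hd.norm_sq.fderiv]
  calc ‖(2 : ℕ) • (innerSL ℝ (f x)).comp (fderiv ℝ f x)‖
      ≤ 2 * ‖(innerSL ℝ (f x)).comp (fderiv ℝ f x)‖ := by
        rw [two_nsmul, two_mul]; exact norm_add_le _ _
    _ ≤ 2 * (‖innerSL ℝ (f x)‖ * ‖fderiv ℝ f x‖) := by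
        gcongr; exact ContinuousLinearMap.opNorm_comp_le _ _
    _ ≤ 2 * ‖f x‖ * Real.sqrt (frobeniusNormSq (fderiv ℝ f x)) := by
        rw [innerSL_apply_norm, mul_assoc]
        gcongr
        rw [← Real.sqrt_sq (norm_nonneg (fderiv ℝ f x))]
        exact Real.sqrt_le_sqrt (sq_opNorm_le_frobeniusNormSq _)

/-- `‖∇|f|²‖₁ ≤ 2 ‖f‖₂ ‖∇f‖₂` (Cauchy–Schwarz). -/
theorem lintegral_enorm_fderiv_norm_sq_le {f : (EuclideanSpace ℝ (Fin 3)) → (EuclideanSpace ℝ (Fin 3))} (hf : ContDiff ℝ 1 f) :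
    ∫⁻ x, ‖fderiv ℝ (fun y => ‖f y‖ ^ 2) x‖ₑ ≤
      2 * (∫⁻ x, ‖f x‖ₑ ^ 2) ^ (1 / 2 : ℝ) *
        (∫⁻ x, ENNReal.ofReal (frobeniusNormSq (fderiv ℝ f x))) ^ (1 / 2 : ℝ) := by
  have hfm : Measurable f := hf.continuous.measurable
  have hFc : Continuous fun x => frobeniusNormSq (fderiv ℝ f x) :=
    continuous_frobeniusNormSq'.comp (hf.continuous_fderiv one_ne_zero)
  have hGm : AEMeasurable (fun x => ENNReal.ofReal (Real.sqrt (frobeniusNormSq (fderiv ℝ f x)))) volume :=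
    (ENNReal.measurable_ofReal.comp (Real.continuous_sqrt.measurable.comp hFc.measurable)).aemeasurable
  -- pointwise
  have hpt : ∀ x, ‖fderiv ℝ (fun y => ‖f y‖ ^ 2) x‖ₑ ≤
      2 * (‖f x‖ₑ * ENNReal.ofReal (Real.sqrt (frobeniusNormSq (fderiv ℝ f x)))) := by
    intro x
    have hreal := norm_fderiv_norm_sq_le hf x
    calc ‖fderiv ℝ (fun y => ‖f y‖ ^ 2) x‖ₑ = ENNReal.ofReal ‖fderiv ℝ (fun y => ‖f y‖ ^ 2) x‖ :=
          (ofReal_norm _).symm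
      _ ≤ ENNReal.ofReal (2 * (‖f x‖ * Real.sqrt (frobeniusNormSq (fderiv ℝ f x)))) :=
          ENNReal.ofReal_le_ofReal (by rw [← mul_assoc]; exact hreal)
      _ = 2 * (‖f x‖ₑ * ENNReal.ofReal (Real.sqrt (frobeniusNormSq (fderiv ℝ f x)))) := by
          rw [ENNReal.ofReal_mul (by norm_num : (0:ℝ) ≤ 2), ENNReal.ofReal_ofNat,
            ENNReal.ofReal_mul (norm_nonneg _), ofReal_norm]
  have hH := ENNReal.lintegral_mul_le_Lp_mul_Lq volume Real.HolderConjugate.two_two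
    hfm.enorm.aemeasurable hGm
  calc ∫⁻ x, ‖fderiv ℝ (fun y => ‖f y‖ ^ 2) x‖ₑ
      ≤ ∫⁻ x, 2 * (‖f x‖ₑ * ENNReal.ofReal (Real.sqrt (frobeniusNormSq (fderiv ℝ f x)))) :=
        lintegral_mono hpt
    _ = 2 * ∫⁻ x, (fun y => ‖f y‖ₑ) x *
          (fun y => ENNReal.ofReal (Real.sqrt (frobeniusNormSq (fderiv ℝ f y)))) x := by
        rw [lintegral_const_mul' _ _ (by norm_num)]
    _ ≤ 2 * ((∫⁻ x, ‖f x‖ₑ ^ (2 : ℝ)) ^ (1 / (2 : ℝ)) *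
          (∫⁻ x, (ENNReal.ofReal (Real.sqrt (frobeniusNormSq (fderiv ℝ f x)))) ^ (2 : ℝ)) ^ (1 / (2 : ℝ))) := by
        gcongr
        simpa only [Pi.mul_apply] using hH
    _ = 2 * (∫⁻ x, ‖f x‖ₑ ^ 2) ^ (1 / 2 : ℝ) *
        (∫⁻ x, ENNReal.ofReal (frobeniusNormSq (fderiv ℝ f x))) ^ (1 / 2 : ℝ) := by
        rw [mul_assoc]
        congr 2
        · congr 1
          exact lintegral_congr fun x => by rw [ENNReal.rpow_two]
        · congr 1
          refine lintegral_congr fun x => ?_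
          rw [ENNReal.rpow_two, ← ENNReal.ofReal_pow (Real.sqrt_nonneg _),
            Real.sq_sqrt (frobeniusNormSq_nonneg _)]

end Summit.NavierStokesRegularity.NavierStokesRegularity.Theorems.L3TimeExponentPincerMorreyGrowth

end
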